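import Summits.BirchSwinnertonDyer.BirchSwinnertonDyer.Theorems.BiquadraticEisensteinDescentHeegnerTwistCouplingInSupplyKrizLiGrossCornerII
import Summits.BirchSwinnertonDyer.BirchSwinnertonDyer.Theorems.PrintCFramBottomClassIndexLawFiveLeKrizLiBindersAnchor19
import Summits.BirchSwinnertonDyer.BirchSwinnertonDyer.Theorems.PrintCFramBottomClassIndexLawFiveLeKrizLiBindersAnchor43
import Summits.BirchSwinnertonDyer.BirchSwinnertonDyer.Theorems.PrintCFramBottomClassIndexLawFiveLeKrizLiBindersAnchor67
import Summits.BirchSwinnertonDyer.BirchSwinnertonDyer.Theorems.PrintCFramBottomClassIndexLawFiveLeKrizLiBindersAnchor163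
import Summits.BirchSwinnertonDyer.BirchSwinnertonDyer.Theorems.PrintCFramBottomClassIndexLawFiveLeKrizLi4CertKit
import Summits.BirchSwinnertonDyer.BirchSwinnertonDyer.Theorems.PrintCFramBottomClassIndexLawFiveLeKrizLi4HeegnerHypothesis
import Mathlib.Tactic.NormNum.LegendreSymbol
import HarnessLib

set_option linter.dupNamespace false -- `Summit.BirchSwinnertonDyer.BirchSwinnertonDyer.Theorems.…` (summit = sub, D-0017)
set_option autoImplicit false

/-!
# Crux `HeegnerTwistCouplingInSupply` (stmt-BirchSwinnertonDyer-21381) — the GROSS-CURVE Kriz–Li corners, part VII: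
# the `ℚ(√−11)` corner BEYOND cell cfram's window, continued — `A(11)^{(p)}` at the inert crux primes `p = 101, 149`, with their certificates

Route `BiquadraticEisensteinDescent` (cell `pub/bsd-wall`, width seat `bsd-wall-cm-bed-w4` g28; `--supports` 21381, helper). As part VI (rows `p = 73, 109`),
with cfram's engine `krizLi_characterBernoulliBlock_twist_odd` and certificate kit `KrizLi4Cert.norm_generalizedBernoulli_eq_one_of_table` (tables
`KrizLiBinders.teichmullerPowTable_11_7/_11_2`, trace form `EisensteinTraceForm.lFunction_cm11_mod`): the classes `A11e101 = A(11)^{(101)}` (`101 ≡ 2 (mod 11)`,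
a non-residue: `101` INERT in `ℚ(√−11)`; `K'' = ℚ(√−19)`) and `A11e149 = A(11)^{(149)}` (`149 ≡ 6 (mod 11)` inert; `K'' = ℚ(√−7)`) — kernel certificates
(`11 ∥ S`; `decide +kernel`, blocks of `10⁴`), unit theorems, character block, Heegner hypothesis and ★ `cruxConclusion_A11e101` / `cruxConclusion_A11e149`:
the CONCLUSION of crux 21381 at `(W, p)` for every globally minimal `W ∼ A(11)^{(p)}` with `r_an(W) ≠ 0`, modulo `hKL`, `hGZ`, `hHP` ONLY.

HONEST FRAMING: two more isogeny classes; the crux (all CM `W`, all `p`), C⁺, its registered stubs and BSD are NOT proved. THEOREMS ONLY.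
Supports stmt-BirchSwinnertonDyer-21381. [cite: KrizLi2019, Thm. 1.20 (pp. 7–8), §1.5 (1), Rem. 1.21] [cite: Washington1997, §5.1, Thm. 4.2]
[cite: GrossLMS1991, §1] [cite: Cox2013, §1.C Lemma 1.14, §2.A Thm. 2.13]
-/

noncomputable section

open scoped Classical NumberTheorySymbols

namespace Summit.BirchSwinnertonDyer.BirchSwinnertonDyer.Theorems.KrizLiGrossCorner

open _root_.WeierstrassCurve NumberField DirichletCharacter
open Literature.NumberTheory.EllipticCurves Literature.NumberTheory.EllipticCurves.KrizLi2019 Literature.NumberTheory.LFunctions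
  Literature.NumberTheory.EllipticCurves.ModularForms Literature.NumberTheory.EllipticCurves.Rank1Residual
  Literature.NumberTheory.QuadraticFields Literature.NumberTheory.QuadraticFields.Quadratic
  Summit.BirchSwinnertonDyer.Rank1Residual Summit.BirchSwinnertonDyer.Rank1Residual.X12.O11
  Summit.BirchSwinnertonDyer.Rank1Residual.X12.O11.RouteU
  Summit.BirchSwinnertonDyer.BirchSwinnertonDyer.Theorems.PrintCFram
  Summit.BirchSwinnertonDyer.BirchSwinnertonDyer.Theorems.PrintCFram.KrizLiBindersTwisted

/-! ## Class `A11e101` = `A(11)^{(101)}` : `ψ = χ_{101}·ω^{3}` (odd twisting discriminant), `K'' = ℚ(√-19)`, crux prime `p = 101` -/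

set_option maxRecDepth 400000 in
/-- Certificate sum for `θ₁` of `A11e101`: `S = Σ_{j<1111} χ(j)·t(j mod 11)·j = 1183215` (`11 ∥ S`), Jacobi symbols by Euler's criterion in `ℕ`,
`decide +kernel`. [cite: KrizLi2019, §1.5 display (1) (p. 7)] -/
theorem certSum1_A11e101 :
    ∑ j ∈ Finset.range (11 * 101), (J((j : ℤ) | 101) * ((([0, 1, 40, 9, 27, 3, 118, 94, 112, 81, 120] : List ℕ).getD (j % 11) 0 : ℕ) : ℤ)) * (j : ℤ) ^ (0 + 1) = 1183215 := by
  simp_rw [RouteU.jacobiSym_prime_eq_ite_nat 101 (by norm_num) (by norm_num)]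
  decide +kernel

/-- **`‖B_{1,θ₁}‖_{11} = 1` for the class `A11e101`** (`A(11)^{(101)}`): for every Teichmüller `ω` mod `11` and every `ℚ_11`-valued `θ₁`
mod `11·101` with values `χ_{101}(j)·ω(j)^{7}` (`= ψ⁻¹`, `ψ = χ_{101}·ω^{3}`), `B_{1,θ₁}` is a `11`-adic unit — the CLASS FACTOR of
Kriz–Li's (4). Witness of `θ ≠ 1`: `θ(12) = −1`. [cite: KrizLi2019, Thm. 1.20 (p. 8, hypothesis (4)) and §1.5 (1) (p. 7)]
[cite: Washington1997, §5.1 and Thm. 4.2] -/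
theorem norm_generalizedBernoulli_theta1_A11e101 [Fact (Nat.Prime 11)] (ω : DirichletCharacter ℚ_[11] 11)
    (hω : IsTeichmullerCharacter ω) (θ : DirichletCharacter ℚ_[11] (11 * 101))
    (hθ : ∀ j : ZMod (11 * 101), θ j = (J((j.val : ℤ) | 101) : ℚ_[11]) * ω (j.val : ZMod 11) ^ 7) :
    ‖generalizedBernoulli 1 θ‖ = 1 :=
  @KrizLi4Cert.norm_generalizedBernoulli_eq_one_of_table 11 101 _ ⟨by norm_num⟩ ω hω 7 (by norm_num)
    (KrizLi4Cert.padicValNat_mul_eq_one (by norm_num)) (fun a => J((a : ℤ) | 101)) θ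
    (fun j => by rw [hθ j]) 12 (by norm_num) (by norm_num) (by norm_num) (by norm_num)
    (fun j => ([0, 1, 40, 9, 27, 3, 118, 94, 112, 81, 120] : List ℕ).getD j 0) rfl KrizLiBinders.teichmullerPowTable_11_7 (1183215) certSum1_A11e101
    (by norm_num) (by norm_num)

set_option maxRecDepth 400000 in
/-- Block 0 (`0 ≤ j < 10000`) of the certificate sum for `θ₂` of `A11e101` (`decide +kernel`). [cite: KrizLi2019, §1.5 display (1) (p. 7)] -/
theorem certSum2_A11e101_block0 :
    ∑ j ∈ Finset.Ico (0 : ℕ) 10000, (J((j : ℤ) | 101) * J((j : ℤ) | 19) * ((([0, 1, 81, 9, 27, 3, 3, 27, 9, 81, 1] : List ℕ).getD (j % 11) 0 : ℕ) : ℤ)) * (j : ℤ) ^ (0 + 1) = 6858028 := by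
  simp_rw [RouteU.jacobiSym_prime_eq_ite_nat 101 (by norm_num) (by norm_num), RouteU.jacobiSym_prime_eq_ite_nat 19 (by norm_num) (by norm_num)]
  decide +kernel

set_option maxRecDepth 400000 in
/-- Block 1 (`10000 ≤ j < 20000`) of the certificate sum for `θ₂` of `A11e101` (`decide +kernel`). [cite: KrizLi2019, §1.5 display (1) (p. 7)] -/
theorem certSum2_A11e101_block1 :
    ∑ j ∈ Finset.Ico (10000 : ℕ) 20000, (J((j : ℤ) | 101) * J((j : ℤ) | 19) * ((([0, 1, 81, 9, 27, 3, 3, 27, 9, 81, 1] : List ℕ).getD (j % 11) 0 : ℕ) : ℤ)) * (j : ℤ) ^ (0 + 1) = -33611640 := by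
  simp_rw [RouteU.jacobiSym_prime_eq_ite_nat 101 (by norm_num) (by norm_num), RouteU.jacobiSym_prime_eq_ite_nat 19 (by norm_num) (by norm_num)]
  decide +kernel

set_option maxRecDepth 400000 in
/-- Block 2 (`20000 ≤ j < 21109`) of the certificate sum for `θ₂` of `A11e101` (`decide +kernel`). [cite: KrizLi2019, §1.5 display (1) (p. 7)] -/
theorem certSum2_A11e101_block2 :
    ∑ j ∈ Finset.Ico (20000 : ℕ) (11 * 1919), (J((j : ℤ) | 101) * J((j : ℤ) | 19) * ((([0, 1, 81, 9, 27, 3, 3, 27, 9, 81, 1] : List ℕ).getD (j % 11) 0 : ℕ) : ℤ)) * (j : ℤ) ^ (0 + 1) = -32604896 := by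
  simp_rw [RouteU.jacobiSym_prime_eq_ite_nat 101 (by norm_num) (by norm_num), RouteU.jacobiSym_prime_eq_ite_nat 19 (by norm_num) (by norm_num)]
  decide +kernel

/-- The certificate sum for `θ₂` of `A11e101` assembled from its 3 block(s): `S = Σ_{j<21109} χ(j)·t(j mod 11)·j = -59358508` (`11 ∥ S`).
[cite: KrizLi2019, §1.5 display (1) (p. 7)] -/
theorem certSum2_A11e101 :
    ∑ j ∈ Finset.range (11 * 1919), (J((j : ℤ) | 101) * J((j : ℤ) | 19) * ((([0, 1, 81, 9, 27, 3, 3, 27, 9, 81, 1] : List ℕ).getD (j % 11) 0 : ℕ) : ℤ)) * (j : ℤ) ^ (0 + 1) = -59358508 := by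
  rw [Finset.range_eq_Ico,
    ← Finset.sum_Ico_consecutive _ (show 0 ≤ 10000 by norm_num) (show 10000 ≤ 11 * 1919 by norm_num),
    ← Finset.sum_Ico_consecutive _ (show 10000 ≤ 20000 by norm_num) (show 20000 ≤ 11 * 1919 by norm_num),
    certSum2_A11e101_block0, certSum2_A11e101_block1, certSum2_A11e101_block2]
  norm_num

/-- **`‖B_{1,θ₂}‖_{11} = 1` for the class `A11e101` over `K'' = ℚ(√-19)`**: for every Teichmüller `ω` mod `11` and every `ℚ_11`-valued `θ₂`
mod `11·1919` with values `χ_{101}(j)·(j/19)·ω(j)^{2}` (`= ψ·ε_K·ω⁻¹`), `B_{1,θ₂}` is a `11`-adic unit — the `K''`-FACTOR of Kriz–Li's (4).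
Witness of `θ ≠ 1`: `θ(56) = −1`. [cite: KrizLi2019, Thm. 1.20 (p. 8, hypothesis (4)) and §1.5 (1) (p. 7)] [cite: Washington1997, §5.1 and Thm. 4.2] -/
theorem norm_generalizedBernoulli_theta2_A11e101 [Fact (Nat.Prime 11)] (ω : DirichletCharacter ℚ_[11] 11)
    (hω : IsTeichmullerCharacter ω) (θ : DirichletCharacter ℚ_[11] (11 * 1919))
    (hθ : ∀ j : ZMod (11 * 1919), θ j = (J((j.val : ℤ) | 101) : ℚ_[11]) * (J((j.val : ℤ) | 19) : ℚ_[11]) * ω (j.val : ZMod 11) ^ 2) :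
    ‖generalizedBernoulli 1 θ‖ = 1 :=
  @KrizLi4Cert.norm_generalizedBernoulli_eq_one_of_table 11 1919 _ ⟨by norm_num⟩ ω hω 2 (by norm_num)
    (KrizLi4Cert.padicValNat_mul_eq_one (by norm_num)) (fun a => J((a : ℤ) | 101) * J((a : ℤ) | 19)) θ
    (fun j => by rw [hθ j]; push_cast; ring) 56 (by norm_num) (by norm_num) (by norm_num) (by norm_num)
    (fun j => ([0, 1, 81, 9, 27, 3, 3, 27, 9, 81, 1] : List ℕ).getD j 0) rfl KrizLiBinders.teichmullerPowTable_11_2 (-59358508) certSum2_A11e101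
    (by norm_num) (by norm_num)

/-- **`A11e101 = A(11)^{(101)}` lies ON the Kriz–Li locus at `p_KL = 11` BY NAME over every quadratic `K''` of discriminant `-19`**: the
character ∧ `ε_K` ∧ Bernoulli block (`ψ = χ_{101}·ω^{3}`; cfram's engine `krizLi_characterBernoulliBlock_twist_odd` fed with the trace
form `a_ℓ(A(11)) ≡ ℓ^{3} + ℓ^{8}` and the two certificates above). [cite: KrizLi2019, Thm. 1.20 (pp. 7–8), Rem. 1.21, §2 (p. 12)]
[cite: Cox2013, §1.C Lemma 1.14] -/
theorem exists_krizLiCharacterBlock_A11e101 [Fact (Nat.Prime 11)] (W W₁ : WeierstrassCurve ℚ) [W.IsElliptic] [W₁.IsElliptic]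
    (hiso : IsIsogenous W W₁) (hW₁ : ∃ C : VariableChange ℚ, C • W₁ = cm11.quadraticTwist ((101 : ℤ) : ℚ))
    (K : Type) [Field K] [NumberField K] (hK2 : Module.finrank ℚ K = 2)
    (hdK : NumberField.discr K = -19) [NeZero (NumberField.discr K).natAbs] :
    ∃ (f : ℕ) (_ : NeZero f) (ψ : DirichletCharacter ℚ_[11] f) (ω : DirichletCharacter ℚ_[11] 11)
      (εK : DirichletCharacter ℚ_[11] (NumberField.discr K).natAbs),
      ψ.IsPrimitive ∧ IsTeichmullerCharacter ω ∧
      (∀ ℓ : ℕ, ℓ.Prime → ¬ (ℓ ∣ 11 * W.conductorNorm ℤ) →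
        ‖((W.LFunction ℓ : ℤ) : ℚ_[11]) - (ψ (ℓ : ZMod f) + ψ⁻¹ (ℓ : ZMod f) * ω (ℓ : ZMod 11))‖ < 1) ∧
      (ψ ((11 : ℕ) : ZMod f) ≠ 1 ∧ primVal (invMulOmega ψ ω) 11 ≠ 1) ∧
      (∀ ℓ : ℕ, (hℓ : ℓ.Prime) → ℓ ≠ 11 →
        (haveI := Fact.mk hℓ; ¬ W.HasGoodReductionAtPrime ℓ ∧ ¬ W.HasMultiplicativeReductionAtPrime ℓ) →
        ψ (ℓ : ZMod f) ≠ 1 ∧ primVal (invMulOmega ψ ω) ℓ ≠ 1) ∧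
      IsKroneckerCharacterOf K εK ∧
      ¬ (‖bernoulliOnePrim (bernoulliCharOne ψ εK) * bernoulliOnePrim (bernoulliCharTwo ψ εK ω)‖ ≤ ((11 : ℕ) : ℝ)⁻¹) ∧
      ψ.Odd := by
  haveI : Fact (Nat.Prime 19) := ⟨by norm_num⟩
  obtain ⟨ω, hω⟩ := exists_isTeichmullerCharacter (p := 11)
  obtain ⟨εK, hεK, hεKval⟩ := KrizLiBinders.exists_isKroneckerCharacterOf_of_discr (p := 11) hK2
    (Nat.Prime.prime (by norm_num : Nat.Prime 19)).squarefree (Or.inr ⟨hdK, by norm_num⟩)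
  have hd : (NumberField.discr K).natAbs = 19 := by rw [hdK]; rfl
  haveI : NeZero ((101 : ℤ)).natAbs := ⟨by decide⟩
  obtain ⟨χ, hχ⟩ := KrizLiBinders.exists_jacobiCharPadic (p := 11) ((101 : ℤ)).natAbs
  have hpar : χ (-1) * (-1) ^ 3 = -1 := by
    have e : ((100 : ℕ) : ZMod ((101 : ℤ)).natAbs) = -1 := by decide
    rw [← e, hχ 100]; norm_num
  obtain ⟨f, hf, ψ, hprim, hodd, hss, h1, h3, h4⟩ :=
    krizLi_characterBernoulliBlock_twist_odd (p := 11) (by norm_num) cm11 (k := 3) (by norm_num) (by norm_num)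
      (fun r _ hr => EisensteinTraceForm.hasGoodReductionAtPrime_cm11 r hr)
      (fun ℓ _ hℓ => by simpa using EisensteinTraceForm.lFunction_cm11_mod ℓ hℓ) W W₁ hiso (e := 101) (by norm_num)
      (by rw [← Int.squarefree_natAbs]; exact (Nat.Prime.prime (by norm_num : Nat.Prime 101)).squarefree) (by norm_num) hW₁ χ hχ hpar ω hω
      (q := 19) (by norm_num) (by norm_num) (by norm_num) hd εK hεKval
      (fun θ₁ hθ₁ => norm_generalizedBernoulli_theta1_A11e101 ω hω θ₁ hθ₁)
      (fun θ₂ hθ₂ => norm_generalizedBernoulli_theta2_A11e101 ω hω θ₂ (fun j => by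
        have h : θ₂ j = (J((j.val : ℤ) | 101 * 19) : ℚ_[11]) * ω (j.val : ZMod 11) ^ 2 := hθ₂ j
        refine h.trans ?_
        rw [RouteU.jacobiSym_mul_right' _ (by norm_num) (by norm_num)]; push_cast; ring))
  exact ⟨f, hf, ψ, ω, εK, hprim, hω, hss, h1, h3, hεK, by exact_mod_cast h4, hodd⟩

/-- **Heegner hypothesis for `A11e101` (`A(11)^{(101)}`) over every quadratic `K''` with `d_{K''} = -19`**: the primes of `N_W` lie in
{`11`, `101`} and both split in `K''`. [cite: GrossLMS1991, §1 (p. 235)] [cite: Cox2013, §1.C (1.18)] -/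
theorem satisfiesHeegnerHypothesis_A11e101 [Fact (Nat.Prime 11)] (W W₁ : WeierstrassCurve ℚ) [W.IsElliptic] [W₁.IsElliptic]
    (hiso : IsIsogenous W W₁) (hW₁ : ∃ C : VariableChange ℚ, C • W₁ = cm11.quadraticTwist ((101 : ℤ) : ℚ))
    (K : Type) [Field K] [NumberField K] (hK2 : Module.finrank ℚ K = 2) (hdK : NumberField.discr K = -19) :
    SatisfiesHeegnerHypothesis (W.conductorNorm ℤ) K := by
  refine satisfiesHeegnerHypothesis_of_twist_emod_four cm11 (fun r _ hr => EisensteinTraceForm.hasGoodReductionAtPrime_cm11 r hr)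
    W W₁ hiso (e := 101) (by norm_num) hW₁ K (fun ℓ hℓ h => ?_)
  have hcases : ℓ = 11 ∨ ℓ = 101 := by
    rcases h with h | hd
    · exact Or.inl h
    · exact Or.inr ((Nat.prime_dvd_prime_iff_eq hℓ (by norm_num : Nat.Prime 101)).mp (by exact_mod_cast hd))
  rcases hcases with rfl | rfl
  · rw [Quadratic.ncard_primesOver_eq_two_iff_jacobiSym hK2 (by norm_num) (by norm_num), hdK]; norm_num
  · rw [Quadratic.ncard_primesOver_eq_two_iff_jacobiSym hK2 (by norm_num) (by norm_num), hdK]; norm_num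

/-- ★ **`A11e101 = A(11)^{(101)}`, crux prime `p = 101`** (`(101/11) = −1`: `101` is INERT in `ℚ(√−11)`; `K′ = ℚ(√−19)`, `h = 1`):
for every globally minimal `W` `ℚ`-isogenous to a curve `ℚ`-isomorphic to `cm11.quadraticTwist 101` with `r_an(W) ≠ 0`, the CONCLUSION of
crux 21381 at `(W, 101)`, modulo `hKL`, `hGZ`, `hHP`. [cite: KrizLi2019, Thm. 1.20 (pp. 7–8)] [cite: Cox2013, §2.A Thm. 2.13] -/
theorem cruxConclusion_A11e101 (hKL : thm120_padicLogHeegner_unit_of_bernoulli)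
    (hGZ : ∀ (N : ℕ) [NeZero N] (W : WeierstrassCurve ℚ) (K : Type) [Field K] [NumberField K], gross_zagier N W K)
    (hHP : ∀ (W : WeierstrassCurve ℚ) (K : Type) [Field K] [NumberField K], exists_isHeegnerPoint W K)
    (W W₁ : WeierstrassCurve ℚ) [W.IsElliptic] [W.IsGloballyMinimal] [NeZero (W.conductorNorm ℤ)] [W₁.IsElliptic]
    (hiso : IsIsogenous W W₁) (hW₁ : ∃ C : VariableChange ℚ, C • W₁ = cm11.quadraticTwist ((101 : ℤ) : ℚ))
    (hr : W.analyticRank ≠ 0) :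
    ∃ (K : Type) (_ : Field K) (_ : NumberField K),
      IsImaginaryQuadratic K ∧ 4 < (NumberField.discr K).natAbs ∧
      SatisfiesHeegnerHypothesis (W.conductorNorm ℤ) K ∧
      (W.quadraticTwist (NumberField.discr K : ℚ)).entireLFunction 1 ≠ 0 ∧ ¬ 101 ∣ NumberField.classNumber K := by
  haveI : Fact (Nat.Prime 11) := ⟨by norm_num⟩
  exact cruxConclusion_of_block (q := 11) (by norm_num) hKL hGZ hHP cm11 KrizLiBinders.hasCM_bases.2.1
    KrizLiBinders.cmRamified_bases.2.1 W W₁ hiso (by norm_num) hW₁ hr (d := -19) (h := 1) (by norm_num) (by norm_num)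
    (by rw [show (-19 : ℤ).natAbs = 19 from rfl]; exact (show Nat.Prime 19 by norm_num).squarefree)
    (by norm_num) (by decide +kernel) (by norm_num)
    (fun K _ _ hK2 hdK => exists_krizLiCharacterBlock_A11e101 W W₁ hiso hW₁ K hK2 hdK)
    (fun K _ _ hK2 hdK => satisfiesHeegnerHypothesis_A11e101 W W₁ hiso hW₁ K hK2 hdK)

/-! ## Class `A11e149` = `A(11)^{(149)}` : `ψ = χ_{149}·ω^{3}` (odd twisting discriminant), `K'' = ℚ(√-7)`, crux prime `p = 149` -/

set_option maxRecDepth 400000 in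
/-- Certificate sum for `θ₁` of `A11e149`: `S = Σ_{j<1639} χ(j)·t(j mod 11)·j = 40975` (`11 ∥ S`), Jacobi symbols by Euler's criterion in `ℕ`,
`decide +kernel`. [cite: KrizLi2019, §1.5 display (1) (p. 7)] -/
theorem certSum1_A11e149 :
    ∑ j ∈ Finset.range (11 * 149), (J((j : ℤ) | 149) * ((([0, 1, 40, 9, 27, 3, 118, 94, 112, 81, 120] : List ℕ).getD (j % 11) 0 : ℕ) : ℤ)) * (j : ℤ) ^ (0 + 1) = 40975 := by
  simp_rw [RouteU.jacobiSym_prime_eq_ite_nat 149 (by norm_num) (by norm_num)]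
  decide +kernel

/-- **`‖B_{1,θ₁}‖_{11} = 1` for the class `A11e149`** (`A(11)^{(149)}`): for every Teichmüller `ω` mod `11` and every `ℚ_11`-valued `θ₁`
mod `11·149` with values `χ_{149}(j)·ω(j)^{7}` (`= ψ⁻¹`, `ψ = χ_{149}·ω^{3}`), `B_{1,θ₁}` is a `11`-adic unit — the CLASS FACTOR of
Kriz–Li's (4). Witness of `θ ≠ 1`: `θ(12) = −1`. [cite: KrizLi2019, Thm. 1.20 (p. 8, hypothesis (4)) and §1.5 (1) (p. 7)]
[cite: Washington1997, §5.1 and Thm. 4.2] -/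
theorem norm_generalizedBernoulli_theta1_A11e149 [Fact (Nat.Prime 11)] (ω : DirichletCharacter ℚ_[11] 11)
    (hω : IsTeichmullerCharacter ω) (θ : DirichletCharacter ℚ_[11] (11 * 149))
    (hθ : ∀ j : ZMod (11 * 149), θ j = (J((j.val : ℤ) | 149) : ℚ_[11]) * ω (j.val : ZMod 11) ^ 7) :
    ‖generalizedBernoulli 1 θ‖ = 1 :=
  @KrizLi4Cert.norm_generalizedBernoulli_eq_one_of_table 11 149 _ ⟨by norm_num⟩ ω hω 7 (by norm_num)
    (KrizLi4Cert.padicValNat_mul_eq_one (by norm_num)) (fun a => J((a : ℤ) | 149)) θ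
    (fun j => by rw [hθ j]) 12 (by norm_num) (by norm_num) (by norm_num) (by norm_num)
    (fun j => ([0, 1, 40, 9, 27, 3, 118, 94, 112, 81, 120] : List ℕ).getD j 0) rfl KrizLiBinders.teichmullerPowTable_11_7 (40975) certSum1_A11e149
    (by norm_num) (by norm_num)

set_option maxRecDepth 400000 in
/-- Block 0 (`0 ≤ j < 10000`) of the certificate sum for `θ₂` of `A11e149` (`decide +kernel`). [cite: KrizLi2019, §1.5 display (1) (p. 7)] -/
theorem certSum2_A11e149_block0 :
    ∑ j ∈ Finset.Ico (0 : ℕ) 10000, (J((j : ℤ) | 149) * J((j : ℤ) | 7) * ((([0, 1, 81, 9, 27, 3, 3, 27, 9, 81, 1] : List ℕ).getD (j % 11) 0 : ℕ) : ℤ)) * (j : ℤ) ^ (0 + 1) = 13933580 := by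
  simp_rw [RouteU.jacobiSym_prime_eq_ite_nat 149 (by norm_num) (by norm_num), RouteU.jacobiSym_prime_eq_ite_nat 7 (by norm_num) (by norm_num)]
  decide +kernel

set_option maxRecDepth 400000 in
/-- Block 1 (`10000 ≤ j < 11473`) of the certificate sum for `θ₂` of `A11e149` (`decide +kernel`). [cite: KrizLi2019, §1.5 display (1) (p. 7)] -/
theorem certSum2_A11e149_block1 :
    ∑ j ∈ Finset.Ico (10000 : ℕ) (11 * 1043), (J((j : ℤ) | 149) * J((j : ℤ) | 7) * ((([0, 1, 81, 9, 27, 3, 3, 27, 9, 81, 1] : List ℕ).getD (j % 11) 0 : ℕ) : ℤ)) * (j : ℤ) ^ (0 + 1) = 1669700 := by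
  simp_rw [RouteU.jacobiSym_prime_eq_ite_nat 149 (by norm_num) (by norm_num), RouteU.jacobiSym_prime_eq_ite_nat 7 (by norm_num) (by norm_num)]
  decide +kernel

/-- The certificate sum for `θ₂` of `A11e149` assembled from its 2 block(s): `S = Σ_{j<11473} χ(j)·t(j mod 11)·j = 15603280` (`11 ∥ S`).
[cite: KrizLi2019, §1.5 display (1) (p. 7)] -/
theorem certSum2_A11e149 :
    ∑ j ∈ Finset.range (11 * 1043), (J((j : ℤ) | 149) * J((j : ℤ) | 7) * ((([0, 1, 81, 9, 27, 3, 3, 27, 9, 81, 1] : List ℕ).getD (j % 11) 0 : ℕ) : ℤ)) * (j : ℤ) ^ (0 + 1) = 15603280 := by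
  rw [Finset.range_eq_Ico,
    ← Finset.sum_Ico_consecutive _ (show 0 ≤ 10000 by norm_num) (show 10000 ≤ 11 * 1043 by norm_num),
    certSum2_A11e149_block0, certSum2_A11e149_block1]
  norm_num

/-- **`‖B_{1,θ₂}‖_{11} = 1` for the class `A11e149` over `K'' = ℚ(√-7)`**: for every Teichmüller `ω` mod `11` and every `ℚ_11`-valued `θ₂`
mod `11·1043` with values `χ_{149}(j)·(j/7)·ω(j)^{2}` (`= ψ·ε_K·ω⁻¹`), `B_{1,θ₂}` is a `11`-adic unit — the `K''`-FACTOR of Kriz–Li's (4).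
Witness of `θ ≠ 1`: `θ(23) = −1`. [cite: KrizLi2019, Thm. 1.20 (p. 8, hypothesis (4)) and §1.5 (1) (p. 7)] [cite: Washington1997, §5.1 and Thm. 4.2] -/
theorem norm_generalizedBernoulli_theta2_A11e149 [Fact (Nat.Prime 11)] (ω : DirichletCharacter ℚ_[11] 11)
    (hω : IsTeichmullerCharacter ω) (θ : DirichletCharacter ℚ_[11] (11 * 1043))
    (hθ : ∀ j : ZMod (11 * 1043), θ j = (J((j.val : ℤ) | 149) : ℚ_[11]) * (J((j.val : ℤ) | 7) : ℚ_[11]) * ω (j.val : ZMod 11) ^ 2) :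
    ‖generalizedBernoulli 1 θ‖ = 1 :=
  @KrizLi4Cert.norm_generalizedBernoulli_eq_one_of_table 11 1043 _ ⟨by norm_num⟩ ω hω 2 (by norm_num)
    (KrizLi4Cert.padicValNat_mul_eq_one (by norm_num)) (fun a => J((a : ℤ) | 149) * J((a : ℤ) | 7)) θ
    (fun j => by rw [hθ j]; push_cast; ring) 23 (by norm_num) (by norm_num) (by norm_num) (by norm_num)
    (fun j => ([0, 1, 81, 9, 27, 3, 3, 27, 9, 81, 1] : List ℕ).getD j 0) rfl KrizLiBinders.teichmullerPowTable_11_2 (15603280) certSum2_A11e149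
    (by norm_num) (by norm_num)

/-- **`A11e149 = A(11)^{(149)}` lies ON the Kriz–Li locus at `p_KL = 11` BY NAME over every quadratic `K''` of discriminant `-7`**: the
character ∧ `ε_K` ∧ Bernoulli block (`ψ = χ_{149}·ω^{3}`; cfram's engine `krizLi_characterBernoulliBlock_twist_odd` fed with the trace
form `a_ℓ(A(11)) ≡ ℓ^{3} + ℓ^{8}` and the two certificates above). [cite: KrizLi2019, Thm. 1.20 (pp. 7–8), Rem. 1.21, §2 (p. 12)]
[cite: Cox2013, §1.C Lemma 1.14] -/
theorem exists_krizLiCharacterBlock_A11e149 [Fact (Nat.Prime 11)] (W W₁ : WeierstrassCurve ℚ) [W.IsElliptic] [W₁.IsElliptic]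
    (hiso : IsIsogenous W W₁) (hW₁ : ∃ C : VariableChange ℚ, C • W₁ = cm11.quadraticTwist ((149 : ℤ) : ℚ))
    (K : Type) [Field K] [NumberField K] (hK2 : Module.finrank ℚ K = 2)
    (hdK : NumberField.discr K = -7) [NeZero (NumberField.discr K).natAbs] :
    ∃ (f : ℕ) (_ : NeZero f) (ψ : DirichletCharacter ℚ_[11] f) (ω : DirichletCharacter ℚ_[11] 11)
      (εK : DirichletCharacter ℚ_[11] (NumberField.discr K).natAbs),
      ψ.IsPrimitive ∧ IsTeichmullerCharacter ω ∧
      (∀ ℓ : ℕ, ℓ.Prime → ¬ (ℓ ∣ 11 * W.conductorNorm ℤ) →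
        ‖((W.LFunction ℓ : ℤ) : ℚ_[11]) - (ψ (ℓ : ZMod f) + ψ⁻¹ (ℓ : ZMod f) * ω (ℓ : ZMod 11))‖ < 1) ∧
      (ψ ((11 : ℕ) : ZMod f) ≠ 1 ∧ primVal (invMulOmega ψ ω) 11 ≠ 1) ∧
      (∀ ℓ : ℕ, (hℓ : ℓ.Prime) → ℓ ≠ 11 →
        (haveI := Fact.mk hℓ; ¬ W.HasGoodReductionAtPrime ℓ ∧ ¬ W.HasMultiplicativeReductionAtPrime ℓ) →
        ψ (ℓ : ZMod f) ≠ 1 ∧ primVal (invMulOmega ψ ω) ℓ ≠ 1) ∧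
      IsKroneckerCharacterOf K εK ∧
      ¬ (‖bernoulliOnePrim (bernoulliCharOne ψ εK) * bernoulliOnePrim (bernoulliCharTwo ψ εK ω)‖ ≤ ((11 : ℕ) : ℝ)⁻¹) ∧
      ψ.Odd := by
  haveI : Fact (Nat.Prime 7) := ⟨by norm_num⟩
  obtain ⟨ω, hω⟩ := exists_isTeichmullerCharacter (p := 11)
  obtain ⟨εK, hεK, hεKval⟩ := KrizLiBinders.exists_isKroneckerCharacterOf_of_discr (p := 11) hK2
    (Nat.Prime.prime (by norm_num : Nat.Prime 7)).squarefree (Or.inr ⟨hdK, by norm_num⟩)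
  have hd : (NumberField.discr K).natAbs = 7 := by rw [hdK]; rfl
  haveI : NeZero ((149 : ℤ)).natAbs := ⟨by decide⟩
  obtain ⟨χ, hχ⟩ := KrizLiBinders.exists_jacobiCharPadic (p := 11) ((149 : ℤ)).natAbs
  have hpar : χ (-1) * (-1) ^ 3 = -1 := by
    have e : ((148 : ℕ) : ZMod ((149 : ℤ)).natAbs) = -1 := by decide
    rw [← e, hχ 148]; norm_num
  obtain ⟨f, hf, ψ, hprim, hodd, hss, h1, h3, h4⟩ :=
    krizLi_characterBernoulliBlock_twist_odd (p := 11) (by norm_num) cm11 (k := 3) (by norm_num) (by norm_num)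
      (fun r _ hr => EisensteinTraceForm.hasGoodReductionAtPrime_cm11 r hr)
      (fun ℓ _ hℓ => by simpa using EisensteinTraceForm.lFunction_cm11_mod ℓ hℓ) W W₁ hiso (e := 149) (by norm_num)
      (by rw [← Int.squarefree_natAbs]; exact (Nat.Prime.prime (by norm_num : Nat.Prime 149)).squarefree) (by norm_num) hW₁ χ hχ hpar ω hω
      (q := 7) (by norm_num) (by norm_num) (by norm_num) hd εK hεKval
      (fun θ₁ hθ₁ => norm_generalizedBernoulli_theta1_A11e149 ω hω θ₁ hθ₁)
      (fun θ₂ hθ₂ => norm_generalizedBernoulli_theta2_A11e149 ω hω θ₂ (fun j => by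
        have h : θ₂ j = (J((j.val : ℤ) | 149 * 7) : ℚ_[11]) * ω (j.val : ZMod 11) ^ 2 := hθ₂ j
        refine h.trans ?_
        rw [RouteU.jacobiSym_mul_right' _ (by norm_num) (by norm_num)]; push_cast; ring))
  exact ⟨f, hf, ψ, ω, εK, hprim, hω, hss, h1, h3, hεK, by exact_mod_cast h4, hodd⟩

/-- **Heegner hypothesis for `A11e149` (`A(11)^{(149)}`) over every quadratic `K''` with `d_{K''} = -7`**: the primes of `N_W` lie in
{`11`, `149`} and both split in `K''`. [cite: GrossLMS1991, §1 (p. 235)] [cite: Cox2013, §1.C (1.18)] -/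
theorem satisfiesHeegnerHypothesis_A11e149 [Fact (Nat.Prime 11)] (W W₁ : WeierstrassCurve ℚ) [W.IsElliptic] [W₁.IsElliptic]
    (hiso : IsIsogenous W W₁) (hW₁ : ∃ C : VariableChange ℚ, C • W₁ = cm11.quadraticTwist ((149 : ℤ) : ℚ))
    (K : Type) [Field K] [NumberField K] (hK2 : Module.finrank ℚ K = 2) (hdK : NumberField.discr K = -7) :
    SatisfiesHeegnerHypothesis (W.conductorNorm ℤ) K := by
  refine satisfiesHeegnerHypothesis_of_twist_emod_four cm11 (fun r _ hr => EisensteinTraceForm.hasGoodReductionAtPrime_cm11 r hr)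
    W W₁ hiso (e := 149) (by norm_num) hW₁ K (fun ℓ hℓ h => ?_)
  have hcases : ℓ = 11 ∨ ℓ = 149 := by
    rcases h with h | hd
    · exact Or.inl h
    · exact Or.inr ((Nat.prime_dvd_prime_iff_eq hℓ (by norm_num : Nat.Prime 149)).mp (by exact_mod_cast hd))
  rcases hcases with rfl | rfl
  · rw [Quadratic.ncard_primesOver_eq_two_iff_jacobiSym hK2 (by norm_num) (by norm_num), hdK]; norm_num
  · rw [Quadratic.ncard_primesOver_eq_two_iff_jacobiSym hK2 (by norm_num) (by norm_num), hdK]; norm_num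

/-- ★ **`A11e149 = A(11)^{(149)}`, crux prime `p = 149`** (`(149/11) = −1`: `149` is INERT in `ℚ(√−11)`; `K′ = ℚ(√−7)`, `h = 1`):
for every globally minimal `W` `ℚ`-isogenous to a curve `ℚ`-isomorphic to `cm11.quadraticTwist 149` with `r_an(W) ≠ 0`, the CONCLUSION of
crux 21381 at `(W, 149)`, modulo `hKL`, `hGZ`, `hHP`. [cite: KrizLi2019, Thm. 1.20 (pp. 7–8)] [cite: Cox2013, §2.A Thm. 2.13] -/
theorem cruxConclusion_A11e149 (hKL : thm120_padicLogHeegner_unit_of_bernoulli)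
    (hGZ : ∀ (N : ℕ) [NeZero N] (W : WeierstrassCurve ℚ) (K : Type) [Field K] [NumberField K], gross_zagier N W K)
    (hHP : ∀ (W : WeierstrassCurve ℚ) (K : Type) [Field K] [NumberField K], exists_isHeegnerPoint W K)
    (W W₁ : WeierstrassCurve ℚ) [W.IsElliptic] [W.IsGloballyMinimal] [NeZero (W.conductorNorm ℤ)] [W₁.IsElliptic]
    (hiso : IsIsogenous W W₁) (hW₁ : ∃ C : VariableChange ℚ, C • W₁ = cm11.quadraticTwist ((149 : ℤ) : ℚ))
    (hr : W.analyticRank ≠ 0) :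
    ∃ (K : Type) (_ : Field K) (_ : NumberField K),
      IsImaginaryQuadratic K ∧ 4 < (NumberField.discr K).natAbs ∧
      SatisfiesHeegnerHypothesis (W.conductorNorm ℤ) K ∧
      (W.quadraticTwist (NumberField.discr K : ℚ)).entireLFunction 1 ≠ 0 ∧ ¬ 149 ∣ NumberField.classNumber K := by
  haveI : Fact (Nat.Prime 11) := ⟨by norm_num⟩
  exact cruxConclusion_of_block (q := 11) (by norm_num) hKL hGZ hHP cm11 KrizLiBinders.hasCM_bases.2.1
    KrizLiBinders.cmRamified_bases.2.1 W W₁ hiso (by norm_num) hW₁ hr (d := -7) (h := 1) (by norm_num) (by norm_num)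
    (by rw [show (-7 : ℤ).natAbs = 7 from rfl]; exact (show Nat.Prime 7 by norm_num).squarefree)
    (by norm_num) (by decide +kernel) (by norm_num)
    (fun K _ _ hK2 hdK => exists_krizLiCharacterBlock_A11e149 W W₁ hiso hW₁ K hK2 hdK)
    (fun K _ _ hK2 hdK => satisfiesHeegnerHypothesis_A11e149 W W₁ hiso hW₁ K hK2 hdK)

end Summit.BirchSwinnertonDyer.BirchSwinnertonDyer.Theorems.KrizLiGrossCorner

end
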